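import Summits.MatrixMultiplication.OmegaCensus.DominoLineCertificate
import HarnessLib

/-!
# Two uniform obstructions to the normalised line identity (every modulus `q`, no certificates)

ω-census `pub-omega`, family (b3), seat pub-omega-group gen 22.  Framing: lottery ticket; floor = certified bounds/negative
ranges.  VALUE: kernel lemmas valid for EVERY cyclic quotient `ZMod q` at once, explaining two families of line projections that
never need a per-prime certificate in the `ℤ_p²`-column tables; NOT progress on ω.

The normalised line identity of `DominoLineCertificate.line_identity_of_shifted_form` reads
`Σ_v (F(τ−v) + F(v−τ) + F(τ+v))·G(v) + [s = τ] = K` for all `τ : ZMod q`.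
* `no_line_identity_of_dvd`: if an integer `d ≥ 2` divides every value of `F` (e.g. the whole part projects to ONE point,
  `F = d·δ`, or `F = 2δ_a + 2δ_b`), there is no solution: `d ∣ K` and `d ∣ K − 1`.
* `no_line_identity_of_symmetric`: if `F` is symmetric (`F(−v) = F(v)`, e.g. the projection `{−t, 0, t}` of a zero-sum
  triangle, or `2δ_0 + δ_k + δ_{−k}`) and `q ≥ 3`, there is no solution: adding the identities at `τ` and `−τ` gives
  `3·(…) = 2K − [s = τ] − [s = −τ]`, so `3 ∣ 2K` (some `τ ∉ {s, −s}`) and `3 ∣ 2K − 1` or `3 ∣ 2K − 2` (`τ = s`).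
-/

namespace Summit.MatrixMultiplication.OmegaCensus

open Finset

variable {q : ℕ} [NeZero q]

/-- **Divisibility obstruction**: if `d ≥ 2` divides every value of `F`, the normalised line identity has no solution.
[folklore] -/
theorem no_line_identity_of_dvd {F G : ZMod q → ℕ} {d : ℕ} (hd : 2 ≤ d) (hF : ∀ v, d ∣ F v) (s : ZMod q) (K : ℕ)
    (hq : 2 ≤ q)
    (hid : ∀ τ : ZMod q, (∑ v : ZMod q, (F (τ - v) + F (v - τ) + F (τ + v)) * G v) + (if s = τ then 1 else 0) = K) :
    False := by
  have hsum : ∀ τ : ZMod q, d ∣ ∑ v : ZMod q, (F (τ - v) + F (v - τ) + F (τ + v)) * G v := fun τ =>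
    Finset.dvd_sum fun v _ => Dvd.dvd.mul_right (Dvd.dvd.add (Dvd.dvd.add (hF _) (hF _)) (hF _)) _
  -- at `τ = s`: `d ∣ K − 1`; at some `τ ≠ s`: `d ∣ K`
  have h1 := hid s
  rw [if_pos rfl] at h1
  have hs1 : s + 1 ≠ s := by
    intro e
    have e1 : (1 : ZMod q) = 0 := by simpa using e
    have := (ZMod.val_eq_zero (1 : ZMod q)).2 e1
    rw [ZMod.val_one'' (by omega)] at this
    exact one_ne_zero this
  have h2 := hid (s + 1)
  rw [if_neg hs1.symm, add_zero] at h2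
  have dK : d ∣ K := h2 ▸ hsum (s + 1)
  have dK1 : d ∣ K - 1 := by
    have := hsum s
    rw [show (∑ v : ZMod q, (F (s - v) + F (v - s) + F (s + v)) * G v) = K - 1 by omega] at this
    exact this
  have hK : 1 ≤ K := by omega
  have : d ∣ K - (K - 1) := Nat.dvd_sub dK dK1
  rw [show K - (K - 1) = 1 by omega] at this
  exact absurd (Nat.le_of_dvd one_pos this) (by omega)

/-- **Symmetry obstruction**: if `F` is symmetric and `q ≥ 3`, the normalised line identity has no solution. [folklore] -/
theorem no_line_identity_of_symmetric {F G : ZMod q → ℕ} (hF : ∀ v, F (-v) = F v) (s : ZMod q) (K : ℕ) (hq : 3 ≤ q)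
    (hid : ∀ τ : ZMod q, (∑ v : ZMod q, (F (τ - v) + F (v - τ) + F (τ + v)) * G v) + (if s = τ then 1 else 0) = K) :
    False := by
  -- the sum of the identities at `τ` and `−τ` is `3·(…) + [s = τ] + [s = −τ] = 2K`
  have key : ∀ τ : ZMod q, 3 ∣ 2 * K - ((if s = τ then 1 else 0) + (if s = -τ then 1 else 0)) := by
    intro τ
    have e1 := hid τ
    have e2 := hid (-τ)
    have hL : (∑ v : ZMod q, (F (τ - v) + F (v - τ) + F (τ + v)) * G v) +
        (∑ v : ZMod q, (F (-τ - v) + F (v - -τ) + F (-τ + v)) * G v) =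
        3 * ∑ v : ZMod q, (F (τ - v) + F (τ + v)) * G v := by
      rw [← sum_add_distrib, mul_sum]
      refine sum_congr rfl fun v _ => ?_
      have a1 : F (v - τ) = F (τ - v) := by rw [← hF (v - τ), neg_sub]
      have a2 : F (-τ - v) = F (τ + v) := by rw [← hF (-τ - v)]; congr 1; ring
      have a3 : F (v - -τ) = F (τ + v) := by congr 1; ring
      have a4 : F (-τ + v) = F (τ - v) := by rw [← hF (-τ + v)]; congr 1; ring
      rw [a1, a2, a3, a4]; ring
    refine ⟨∑ v : ZMod q, (F (τ - v) + F (τ + v)) * G v, ?_⟩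
    omega
  -- a point `τ₀ ∉ {s, −s}` exists since `q ≥ 3`
  have hcard : 3 ≤ (univ : Finset (ZMod q)).card := by rw [card_univ, ZMod.card]; exact hq
  obtain ⟨τ₀, hτ₀, hτ₀'⟩ : ∃ τ₀ : ZMod q, τ₀ ≠ s ∧ τ₀ ≠ -s := by
    have h2 : ({s, -s} : Finset (ZMod q)).card < (univ : Finset (ZMod q)).card :=
      lt_of_lt_of_le (lt_of_le_of_lt (card_insert_le _ _) (by simp)) hcard
    obtain ⟨τ₀, -, hτ₀⟩ := exists_mem_notMem_of_card_lt_card h2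
    simp only [mem_insert, mem_singleton, not_or] at hτ₀
    exact ⟨τ₀, hτ₀.1, hτ₀.2⟩
  have k0 := key τ₀
  rw [if_neg (Ne.symm hτ₀), if_neg (fun e => hτ₀' (by rw [e, neg_neg])), add_zero, Nat.sub_zero] at k0
  have hK : 1 ≤ K := by
    have := hid s
    rw [if_pos rfl] at this
    omega
  have k1 := key s
  rw [if_pos rfl] at k1
  by_cases hs : s = -s
  · rw [if_pos hs] at k1
    omega
  · rw [if_neg hs, add_zero] at k1
    omega

end Summit.MatrixMultiplication.OmegaCensus
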